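import Literature.NumberTheory.GaloisCohomology.LocalInvariantMapSubgroup
import Literature.AnabelianGeometry.AbsoluteAnabelian.LocalResidueMapCorestriction
import Literature.NumberTheory.GaloisRepresentations.LocalFieldFiniteExtension
import Literature.NumberTheory.GaloisRepresentations.AbsGaloisGroupOpenNormal
import Literature.NumberTheory.GaloisRepresentations.CorNaturality
import Literature.NumberTheory.GaloisRepresentations.CorestrictionSubgroupOfConj
import Literature.NumberTheory.GaloisRepresentations.BrauerTowerBound
import Literature.NumberTheory.GaloisRepresentations.LocalTwoMuConjTrivial
import HarnessLib

/-!
# `Cor : H²(L, μₙ) → H²(K_v, μₙ)` is injective for EVERY finite Galois `L/K_v`;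
# the local invariant map `inv_S` of an open normal subgroup is injective; `Gal(L/K_v)` acts trivially on `H²(L, μₙ)`

Let `F` be a non-archimedean local field of characteristic `0`, `n ≥ 1`, and `S ⊴ Γ_F` a closed
NORMAL subgroup of finite index (the absolute Galois group of the finite Galois extension
`L = F̄^S` of `F`, inside `Γ_F`).  Serre, *Corps locaux*, XI §2 Prop. 1 (ii) (for the class formation
of XIII §4): **`Cor_{L/F} : H²(L, μₙ) = Br(L)[n] → H²(F, μₙ) = Br(F)[n]` is injective and
`inv_F ∘ Cor = inv_L`**; consequently (XIII §3, remark after Prop. 7; Milne *ADT* I §1) the natural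
action of `Gal(L/F) = Γ_F/S` on `H²(L, μₙ)` (Serre VII §5) is TRIVIAL: `inv_L ∘ g_* = inv_L` and
`inv_L` is injective.

The tree had the injectivity of `cor` on `H²(S, μₙ)` only for `p`-primary classes when
`p ∤ (Γ_F : S)` (`eq_zero_of_cor_two_mu_eq_zero`, `LocalCorInjective.lean`: a counting argument with
`Cor ∘ Res = (Γ_F : S)`), which does not cover the layers of a `ℤ_p`-tower (`p`-power index).  This
file proves it for ALL classes and every open normal `S`, by the route the docstring of
`LocalInvariantMapSubgroup.lean` names: the field-dialect theorem `Prop121vii.invLevel_corMu`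
(`inv_F ∘ Cor_{E/F} = inv_E`, both residue maps bijective) for the finite extension `E := ↥E₀`,
`E₀ = F̄^S` (`exists_isGalois_fixingSubgroup_eq`), endowed with its OWN local-field structure
(`FiniteExtension.isNonarchimedeanLocalField`: a finite extension of a local field is a local field),
the identification `Gal(F̄/ι⁻¹E) = S` (`embField_eq_of_normal`: a normal `E₀` is its own `ι⁻¹(E₀)`),
and the SURJECTIVITY of the comparison `pullLift : H²(Γ_E, μₙ(Ē)) → H²(S, μₙ(F̄)|_S)` (explicit
inverse: pull back along `res : Γ_E ⥲ S` with `ι` on `μₙ`).  Then, for a number field `K` and a finite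
place `v`, the same statements for the localised coefficients `μₙ(K̄)|_{Γ_{K_v}}` (`muAt K n v`) by
transport along `μₙ(K̄)|_{Γ_{K_v}} ≅ μₙ(K̄_v)` (`muLocalIso`, naturality `cor_cohomologyMap`):

* `pullLift_surjective` — `pullLift F E n q` is onto;
* `cor_two_mu_injective_embField`, **`cor_two_mu_injective`** — `cor S (mu F n) 2` is injective
  (`S = Gal(F̄/ι⁻¹E)`, resp. any closed normal `S` of finite index);
* **`conjMap_two_mu_eq_self`** — `g ∈ Γ_F` acts trivially on `H²(S, μₙ(F̄)|_S)` (`cor_conjMap_two`);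
* **`cor_two_muAt_injective`**, **`localInvariantMapSubgroup_injective`** — at a finite place `v` of a
  number field: `cor_{Γ_{K_v}/S}` and `inv_S = inv_v ∘ cor` (`localInvariantMapSubgroup K n v S`) are
  injective;
* **`conjMap_two_muAt_eq_self`** — `conjMap (muAt K n v).toTopRep S g 2 c = c`: `Gal(K̄_v/K_v)` acts
  trivially on `H²(Gal(K̄_v/L), μₙ) = Br(L)[n]` for every finite Galois `L/K_v` — the local class
  field theory input («(LI)») of the layer-wise Poitou–Tate bookkeeping of the BSD cell
  (`Cruxes/MainConjClauseAtSplitTwoQuadDA/ROW1-COKERNEL-LOCAL-INPUT-cf2c-w8g9.md` §2; consumer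
  `conjMap_two_eq_zsmul_of_twist`, hypothesis `htriv`);
* **`cor_subgroupOf_two_muAt_injective`**, **`conjMap_two_muAt_subgroupOf_eq_self`** — the same two
  statements INSIDE a closed subgroup `Λ ≤ Γ_{K_v}` of finite index taken as the ambient profinite group
  (`cor_{Λ/T}` along `T.subgroupOf Λ` for `T ⊴ Γ_{K_v}` closed normal of finite index, `T ≤ Λ`; the
  action of `g ∈ Λ` on `H²(T.subgroupOf Λ, (μₙ|_Λ)|)`) — the currency of the layer groups `Λ = Λ_n^{(v)}`
  of a `ℤ_p`-tower with `T = Λ ∩ ker θ′` (hypothesis `hconj` of `index_smul_zsmul_eq_zero_of_conjMap_eq_zsmul`),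
  by transitivity `cor_cor_subgroupOf` and the comparison `ofSubgroupOf` (injective: `toSubgroupOf_ofSubgroupOf`);
* `natCard_two_muAt_subgroup_eq`, **`localInvariantMapSubgroup_bijective`** — `|H²(S, μₙ(K̄)|_S)| = n` (every closed `S` of finite
  index, from `natCard_two_mu_eq_of_isOpen` along `muLocalIso`) and hence `inv_S : H²(S, μₙ(K̄)|_S) ⥲ ℤ/n` is BIJECTIVE for `S` normal —
  it IS the invariant map of `L = K̄_v^S` (Serre XIII §3 Cor. 3), the input of layer-wise local Tate duality (`localPairingSubgroup`).

Theorems only (one auxiliary identification `embField_eq_of_normal`); no named fact, no instance,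
no `sorry`.  HONEST FRAMING: classical local class field theory; nothing here bears on BSD by itself.

## References
* J.-P. Serre, *Local Fields* (1979), VII §5, XI §2 Prop. 1 (ii), XIII §3 Prop. 7 and Cor. 3.
  [SerreLocalFields1979]
* J.-P. Serre, *Galois Cohomology* (1997), I §2.4–2.5. [SerreGaloisCohomology1997]
* J. S. Milne, *Arithmetic Duality Theorems* (2006), I §1, I Cor. 2.3. [MilneADT2006]

## Tree search
`lean search 'cor_two_mu_injective|localInvariantMapSubgroup_injective|conjMap_two_mu'`: no prior
declaration; nearest: `eq_zero_of_cor_two_mu_eq_zero` (index prime to `p` only),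
`Prop121vii.invLevel_corMu` (field dialect), `localInvariantMapSubgroup_conjMap` (`inv_S ∘ g_* = inv_S`),
`Literature.AlgebraicGeometry.Frobenioids.PadicKummer.Def22Context.embField_eq_of_normal` (same
identification in the Frobenioid namespace; re-proved here to keep the import graph local).
-/

noncomputable section

open CategoryTheory Function Field IntermediateField

universe u

/-! ### §1. Local fields -/

namespace Literature.NumberTheory.GaloisRepresentations

open _root_.TopRep _root_.ContRepresentation _root_.ContinuousCohomology DiscreteGaloisModule
open LocalWeilDatum
open Literature.AnabelianGeometry.AbsoluteAnabelian

namespace LocalWeilDatum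

/-- **A normal `E₀ ⊆ F̄` is its own `ι⁻¹(E₀)`**: the copy `embField F E₀ = ι⁻¹(E₀) ⊆ F̄` attached to
the chosen `ι : F̄ → Ē₀` is `E₀` itself (every `F`-embedding of a normal `E₀` into `F̄` has image
`E₀`, Mathlib `AlgHom.fieldRange_of_normal`).  (Same statement as the Frobenioid-side
`PadicKummer.Def22Context.embField_eq_of_normal`.) [cite: MilneFT2022, Ch. 7] -/
theorem embField_eq_of_normal {F : Type*} [Field F] (E₀ : IntermediateField F (AlgebraicClosure F))
    [Normal F E₀] : embField F E₀ = E₀ := by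
  let f : E₀ →ₐ[F] AlgebraicClosure F := (embField F E₀).val.comp (equivEmbField F E₀).toAlgHom
  have hf : f.fieldRange = E₀ := AlgHom.fieldRange_of_normal f
  suffices h : embField F E₀ = f.fieldRange from h.trans hf
  refine le_antisymm (fun x hx => ?_) (fun x hx => ?_)
  · refine (AlgHom.mem_fieldRange (f := f) (y := x)).2 ⟨(equivEmbField F E₀).symm ⟨x, hx⟩, ?_⟩
    change (((equivEmbField F E₀) ((equivEmbField F E₀).symm ⟨x, hx⟩) : embField F E₀) :
      AlgebraicClosure F) = x
    rw [AlgEquiv.apply_symm_apply]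
  · obtain ⟨y, rfl⟩ := (AlgHom.mem_fieldRange (f := f) (y := x)).1 hx
    exact ((equivEmbField F E₀) y).2

end LocalWeilDatum

/-! #### `pullLift` is surjective -/

section PullLift

variable (F E : Type u) [Field F] [Field E] [Algebra F E] [Algebra.IsAlgebraic F E] (n : ℕ)

/-- **`pullLift F E n q : H^q(Γ_E, μₙ(Ē)) → H^q(Gal(F̄/E₀), μₙ(F̄)|)` is surjective**: the pull-back
along the inverse pair (`res : Γ_E → Gal(F̄/E₀)`, `ι : μₙ(F̄) → μₙ(Ē)`) is a right inverse
(`res ∘ lift = id`, `ι⁻¹ ∘ ι = id`; functoriality of `ContinuousCohomology.map`).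
[cite: SerreGaloisCohomology1997, I §2.4] -/
theorem pullLift_surjective (q : ℕ) : Surjective (Prop121vii.pullLift F E n q) := by
  intro z
  -- the restriction `Γ_E → Gal(F̄/E₀)` (corestricted) as a continuous homomorphism
  let ψ : absoluteGaloisGroup E →ₜ* galFixing F (embField F E) :=
    { toMonoidHom := (absGaloisRestrict F E : absoluteGaloisGroup E →* absoluteGaloisGroup F).codRestrict
        (galFixing F (embField F E)) (absGaloisRestrict_mem_galFixing F E)
      continuous_toFun := (absGaloisRestrict F E).continuous_toFun.subtype_mk _ }
  -- the coefficient morphism `μₙ(F̄)|_{Gal(F̄/E₀)} → μₙ(Ē)` over `ψ`, given by `ι`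
  let g : TopRep.res (ψ : absoluteGaloisGroup E →* galFixing F (embField F E))
      ((mu F n).restrict (subgroupIncl (galFixing F (embField F E)))).toTopRep ⟶ (mu E n).toTopRep :=
    TopRep.ofHom ⟨⟨(Prop121vii.muRes F E n).toIntLinearMap, continuous_of_discreteTopology⟩, fun σ => by
      refine ContinuousLinearMap.ext fun v => ?_
      exact Prop121vii.muRes_smul F E n σ v⟩
  refine ⟨ContinuousCohomology.map ψ g q z, ?_⟩
  rw [Prop121vii.pullLift_apply,
    ← map_comp_apply_of ψ (Prop121vii.liftGalC F E) (ContinuousMonoidHom.id _)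
      (fun x => Subtype.ext (Prop121vii.absGaloisRestrict_liftGalC F E x).symm) g
      (Prop121vii.liftCoeff F E n)
      (resIdHom (𝟙 ((mu F n).restrict (subgroupIncl (galFixing F (embField F E)))).toTopRep))
      (fun v => (Prop121vii.muResInv_muRes F E n v).symm) q z]
  exact map_apply_of_id (ContinuousMonoidHom.id _) (fun _ => rfl) _ (fun _ => rfl) q z

end PullLift

/-! #### `Cor` is injective on `H²(·, μₙ)`; `Γ_F` acts trivially -/

section Local

variable (F : Type u) [Field F] [ValuativeRel F] [TopologicalSpace F] [IsNonarchimedeanLocalField F]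
  [CharZero F] (n : ℕ) [NeZero n]

attribute [local instance] absoluteGaloisGroup_compactSpace compactSpace_of_isClosed_subgroup
  isClosed_galFixing' LocalWeilDatum.finiteDimensional_embField finite_quot_galFixing Fintype.ofFinite

/-- Transport of the injectivity of `cor` along an equality of subgroups (and across the instance
arguments, which are propositions or subsingletons). [folklore] -/
private theorem cor_injective_of_eq {G : Type u} [Group G] [TopologicalSpace G] [IsTopologicalGroup G]
    [CompactSpace G] [T2Space G] [TotallyDisconnectedSpace G]
    {M : Type u} [AddCommGroup M] [TopologicalSpace M] [DiscreteTopology M]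
    (ρ : ContinuousRep G ℤ M) (q : ℕ) {S T : Subgroup G} {_ : IsClosed (S : Set G)} {_ : Fintype (G ⧸ S)}
    [IsClosed (T : Set G)] [Fintype (G ⧸ T)] (h : S = T) (hS : Injective (cor S ρ q)) :
    Injective (cor T ρ q) := by
  subst h
  convert hS

/-- **`Cor : H²(Gal(F̄/E₀), μₙ) → H²(Γ_F, μₙ)` is injective** for `E₀ = ι⁻¹(E)`, `E/F` any finite
extension of the non-archimedean local field `F` of characteristic `0` (Serre XI §2 Prop. 1 (ii) for
the local class formation): `Cor_{E/F} = cor ∘ pullLift` satisfies `inv_F ∘ Cor_{E/F} = inv_E`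
(`Prop121vii.invLevel_corMu`, with `E` carrying its own local-field structure
`FiniteExtension.isNonarchimedeanLocalField`), `inv_E` is injective, and `pullLift` is onto.
[cite: SerreLocalFields1979, XI §2 Prop. 1 (ii)] -/
theorem cor_two_mu_injective_embField (E : Type u) [Field E] [Algebra F E] [FiniteDimensional F E] :
    Injective (cor (galFixing F (embField F E)) (mu F n) 2) := by
  letI := FiniteExtension.normedField F E
  letI := FiniteExtension.valuativeRel F E
  haveI : IsNonarchimedeanLocalField E := FiniteExtension.isNonarchimedeanLocalField F E
  haveI : CharZero E := charZero_of_injective_algebraMap (algebraMap F E).injective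
  have hcorMu : Injective (Prop121vii.corMu F E n) := fun y y' h =>
    (Prop121vii.isInvariantMap_invLevel E n).1.1 (by
      rw [← Prop121vii.invLevel_corMu F E n y, ← Prop121vii.invLevel_corMu F E n y', h])
  intro a b hab
  obtain ⟨y, rfl⟩ := pullLift_surjective F E n 2 a
  obtain ⟨y', rfl⟩ := pullLift_surjective F E n 2 b
  have h : Prop121vii.corMu F E n y = Prop121vii.corMu F E n y' := hab
  rw [hcorMu h]

/-- **`Cor : H²(S, μₙ(F̄)|_S) → H²(Γ_F, μₙ(F̄))` is injective for every closed NORMAL subgroup `S` of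
finite index of `Γ_F`** (`F` a non-archimedean local field of characteristic `0`; all classes, any —
e.g. `p`-power — index): `S = Gal(F̄/E₀)` for a finite Galois `E₀ ⊆ F̄`
(`exists_isGalois_fixingSubgroup_eq`), `E₀ = ι⁻¹(E₀)` (`embField_eq_of_normal`), and
`cor_two_mu_injective_embField`.  Serre, *Local Fields* XI §2 Prop. 1 (ii).
[cite: SerreLocalFields1979, XI §2 Prop. 1 (ii)] -/
theorem cor_two_mu_injective (S : Subgroup (absoluteGaloisGroup F))
    [IsClosed (S : Set (absoluteGaloisGroup F))] [Fintype (absoluteGaloisGroup F ⧸ S)] [S.Normal] :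
    Injective (cor S (mu F n) 2) := by
  haveI : S.FiniteIndex := Subgroup.finiteIndex_of_finite_quotient
  have hSopen : IsOpen (S : Set (absoluteGaloisGroup F)) := Subgroup.isOpen_of_isClosed_of_finiteIndex S ‹_›
  obtain ⟨E₀, hfin, hgal, hE₀⟩ :=
    @exists_isGalois_fixingSubgroup_eq F (AlgebraicClosure F) _ _ _ _ S ‹S.Normal› hSopen
  haveI := hfin
  haveI := hgal
  have hS : galFixing F (embField F E₀) = S := by
    rw [LocalWeilDatum.embField_eq_of_normal E₀]
    unfold galFixing
    rw [hE₀]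
    exact Subgroup.ext fun _ => Iff.rfl
  exact cor_injective_of_eq (mu F n) 2 hS (cor_two_mu_injective_embField F n E₀)

/-- **`Γ_F` acts trivially on `H²(S, μₙ(F̄)|_S) = Br(F̄^S)[n]`** for `S ⊴ Γ_F` closed normal of finite
index: `cor ∘ (g ·) = cor` (`cor_conjMap_two`) and `cor` is injective (`cor_two_mu_injective`) — the
Galois invariance `inv_{L} ∘ g_* = inv_L` of the invariant map of `L = F̄^S`.
[cite: SerreLocalFields1979, XIII §3 Prop. 7] -/
theorem conjMap_two_mu_eq_self (S : Subgroup (absoluteGaloisGroup F))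
    [IsClosed (S : Set (absoluteGaloisGroup F))] [Fintype (absoluteGaloisGroup F ⧸ S)] [S.Normal]
    (g : absoluteGaloisGroup F) (c : continuousCohomology 2 ((mu F n).restrict (subgroupIncl S)).toTopRep) :
    conjMap (mu F n).toTopRep S g 2 c = c :=
  cor_two_mu_injective F n S (cor_conjMap_two S (mu F n) g c)

end Local

end Literature.NumberTheory.GaloisRepresentations

/-! ### §2. Number fields: the localised coefficients `μₙ(K̄)|_{Γ_{K_v}}` -/

namespace Literature.NumberTheory.GaloisCohomology

open Literature.NumberTheory.GaloisRepresentations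
open Literature.NumberTheory.GaloisRepresentations.DiscreteGaloisModule (mu MuCarrier)
open _root_.TopRep _root_.ContinuousCohomology
open NumberField IsDedekindDomain

attribute [local instance] absoluteGaloisGroup_compactSpace compactSpace_of_isClosed_subgroup
  isClosed_subgroupOf_of_isClosed

variable (K : Type) [Field K] [NumberField K] (n : ℕ) [NeZero n] (v : HeightOneSpectrum (𝓞 K))
  (S : Subgroup (Field.absoluteGaloisGroup (v.adicCompletion K)))
  [hS : IsClosed (S : Set (Field.absoluteGaloisGroup (v.adicCompletion K)))]
  [Fintype (Field.absoluteGaloisGroup (v.adicCompletion K) ⧸ S)]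

/-- **`cor : H²(S, μₙ(K̄)|_S) → H²(Γ_{K_v}, μₙ(K̄)|)` is injective** for `S ⊴ Γ_{K_v}` closed normal of
finite index, on the localised coefficients `muAt K n v = μₙ(K̄)|_{Γ_{K_v}}` — transported from
`cor_two_mu_injective` for the local field `K_v` along `μₙ(K̄)|_{Γ_{K_v}} ≅ μₙ(K̄_v)` (`muLocalIso`,
naturality of `cor` in the coefficients `cor_cohomologyMap`).
[cite: SerreLocalFields1979, XI §2 Prop. 1 (ii)] -/
theorem cor_two_muAt_injective [S.Normal] : Injective (cor S (muAt K n v) 2) := by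
  haveI : CharZero (v.adicCompletion K) := charZero_adicCompletion v
  have hloc := cor_two_mu_injective (v.adicCompletion K) n S
  let e := muLocalIso (K := K) v n
  -- the coefficient isomorphism restricted to `S`, and the induced bijection on `H²(S, ·)`
  let eS : ((muAt K n v).restrict (subgroupIncl S)).toTopRep ≅
      ((mu (v.adicCompletion K) n).restrict (subgroupIncl S)).toTopRep :=
    { hom := resModHom S (ρ := muAt K n v) (ρ' := mu (v.adicCompletion K) n) e.hom
      inv := resModHom S (ρ := mu (v.adicCompletion K) n) (ρ' := muAt K n v) e.inv
      hom_inv_id := TopRep.hom_ext (ContIntertwiningMap.ext (ContinuousLinearMap.ext fun x => by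
        change e.inv.hom (e.hom.hom x) = x
        rw [← TopRep.comp_apply, e.hom_inv_id, TopRep.id_apply]))
      inv_hom_id := TopRep.hom_ext (ContIntertwiningMap.ext (ContinuousLinearMap.ext fun y => by
        change e.hom.hom (e.inv.hom y) = y
        rw [← TopRep.comp_apply, e.inv_hom_id, TopRep.id_apply])) }
  have hT : Injective (cohomologyMap eS.hom 2) := (continuousCohomologyEquivOfIso eS 2).injective
  have key : ∀ z, cor S (mu (v.adicCompletion K) n) 2 (cohomologyMap eS.hom 2 z) =
      cohomologyMap e.hom 2 (cor S (muAt K n v) 2 z) :=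
    fun z => cor_cohomologyMap S (muAt K n v) (mu (v.adicCompletion K) n) e.hom 1 z
  intro a b hab
  apply hT
  apply hloc
  rw [key a, key b, hab]

/-- **The local invariant map `inv_S = inv_v ∘ cor_{Γ_{K_v}/S}` of an open normal subgroup is
injective** (it IS the invariant map `Br(L)[n] ⥲ ℤ/n` of `L = K̄_v^S`, Serre XI §2 Prop. 1 (ii)):
`inv_v` is bijective (`localInvariantMap_bijective`) and `cor` is injective (`cor_two_muAt_injective`).
[cite: SerreLocalFields1979, XI §2 Prop. 1 (ii)] -/
theorem localInvariantMapSubgroup_injective [S.Normal] : Injective (localInvariantMapSubgroup K n v S) :=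
  fun _ _ h => cor_two_muAt_injective K n v S ((localInvariantMap_bijective v).1 h)

/-- **`Gal(K̄_v/K_v)` acts TRIVIALLY on `H²(Gal(K̄_v/L), μₙ) = Br(L)[n]` for every finite Galois
`L/K_v`**: for `S ⊴ Γ_{K_v}` closed normal of finite index, `g ∈ Γ_{K_v}` and
`c ∈ H²(S, μₙ(K̄)|_S)`, `conjMap (muAt K n v).toTopRep S g 2 c = c` — Galois invariance of the layer
invariant map (`localInvariantMapSubgroup_conjMap`: `inv_S ∘ g_* = inv_S`) and its injectivity.  This
is the local class field theory input «(LI)» of the layer-wise Poitou–Tate bookkeeping of the BSD cell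
(`ROW1-COKERNEL-LOCAL-INPUT` §2: hypothesis `htriv` of `conjMap_two_eq_zsmul_of_twist`).
[cite: SerreLocalFields1979, XIII §3 Prop. 7] [cite: MilneADT2006, Ch. I §1] -/
theorem conjMap_two_muAt_eq_self [S.Normal] (g : Field.absoluteGaloisGroup (v.adicCompletion K))
    (c : continuousCohomology 2 ((muAt K n v).restrict (subgroupIncl S)).toTopRep) :
    conjMap (muAt K n v).toTopRep S g 2 c = c :=
  localInvariantMapSubgroup_injective K n v S (localInvariantMapSubgroup_conjMap K n v S g c)

/-! ### §3. Inside a closed subgroup `Λ ≤ Γ_{K_v}` of finite index (ambient group `↥Λ`: the layer groups of a tower) -/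

section InLayer

variable (Λ T : Subgroup (Field.absoluteGaloisGroup (v.adicCompletion K)))
  [IsClosed (Λ : Set (Field.absoluteGaloisGroup (v.adicCompletion K)))]
  [Fintype (Field.absoluteGaloisGroup (v.adicCompletion K) ⧸ Λ)]
  [IsClosed (T : Set (Field.absoluteGaloisGroup (v.adicCompletion K)))]
  [Fintype (Field.absoluteGaloisGroup (v.adicCompletion K) ⧸ T)]
  [Fintype (Λ ⧸ T.subgroupOf Λ)]

omit hS in
/-- **`cor_{Λ/T} : H²(T.subgroupOf Λ, (μₙ(K̄)|_Λ)|) → H²(Λ, μₙ(K̄)|_Λ)` is injective** for closed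
subgroups `T ≤ Λ ≤ Γ_{K_v}` of finite index with `T` NORMAL in `Γ_{K_v}` (the corestriction of the
profinite group `↥Λ` along `T.subgroupOf Λ`, i.e. `Cor_{L_T/L_Λ}` for the fixed fields
`K_v ⊆ L_Λ ⊆ L_T`): `cor_{Γ_{K_v}/Λ} ∘ cor_{Λ/T} = cor_{Γ_{K_v}/T} ∘ ofSubgroupOf` (`cor_cor_subgroupOf`),
`cor_{Γ_{K_v}/T}` is injective (`cor_two_muAt_injective`) and `ofSubgroupOf` is injective
(`toSubgroupOf_ofSubgroupOf`).  Serre XI §2 Prop. 1 (ii) for the layer `L_T/L_Λ`.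
[cite: SerreLocalFields1979, XI §2 Prop. 1 (ii)] -/
theorem cor_subgroupOf_two_muAt_injective [T.Normal] (h : T ≤ Λ) :
    Injective (cor (T.subgroupOf Λ) ((muAt K n v).restrict (subgroupIncl Λ)) 2) := by
  intro a b hab
  have h1 : cor T (muAt K n v) 2 (ofSubgroupOf Λ T (muAt K n v) h 2 a) =
      cor T (muAt K n v) 2 (ofSubgroupOf Λ T (muAt K n v) h 2 b) := by
    rw [← cor_cor_subgroupOf Λ T (muAt K n v) h 2 a, ← cor_cor_subgroupOf Λ T (muAt K n v) h 2 b]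
    exact congrArg (cor Λ (muAt K n v) 2) hab
  have h2 := cor_two_muAt_injective K n v T h1
  rw [← toSubgroupOf_ofSubgroupOf Λ T (muAt K n v) h 2 a, ← toSubgroupOf_ofSubgroupOf Λ T (muAt K n v) h 2 b,
    h2]

omit hS in
/-- **`Λ` acts TRIVIALLY on `H²(T.subgroupOf Λ, (μₙ(K̄)|_Λ)|)`** (`T ≤ Λ ≤ Γ_{K_v}` closed of finite
index, `T ⊴ Γ_{K_v}`): for `g ∈ Λ` and every class `c`,
`conjMap ((muAt K n v).restrict (subgroupIncl Λ)).toTopRep (T.subgroupOf Λ) g 2 c = c` — the tower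
currency (`Λ = Gal(K̄_v/L_n)`, `T = Λ ∩ ker θ′`) of `conjMap_two_muAt_eq_self`: `cor_{Λ/T} ∘ (g ·) = cor_{Λ/T}`
(`cor_conjMap_two` for the profinite group `↥Λ`) and `cor_{Λ/T}` is injective.  This is the `htriv` of
`conjMap_two_eq_zsmul_of_twist` with `G := ↥Λ`, feeding `hconj` of
`index_smul_zsmul_eq_zero_of_conjMap_eq_zsmul`. [cite: SerreLocalFields1979, XIII §3 Prop. 7] -/
theorem conjMap_two_muAt_subgroupOf_eq_self [T.Normal] (h : T ≤ Λ) (g : Λ)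
    (c : continuousCohomology 2 (repSub Λ T (muAt K n v)).toTopRep) :
    conjMap ((muAt K n v).restrict (subgroupIncl Λ)).toTopRep (T.subgroupOf Λ) g 2 c = c :=
  cor_subgroupOf_two_muAt_injective K n v Λ T h
    (cor_conjMap_two (T.subgroupOf Λ) ((muAt K n v).restrict (subgroupIncl Λ)) g c)

end InLayer

/-! ### §4. `|H²(S, μₙ(K̄)|_S)| = n`; the local invariant map of an open normal subgroup is BIJECTIVE -/

omit hS in
/-- **`|H²(S, μₙ(K̄)|_S)| = n`** for every closed subgroup `S ≤ Γ_{K_v}` of finite index (`H²(L, μₙ) = Br(L)[n] ≅ ℤ/n` for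
`L = K̄_v^S`): `natCard_two_mu_eq_of_isOpen` for the local field `K_v`, transported along `μₙ(K̄)|_{Γ_{K_v}} ≅ μₙ(K̄_v)` (`muLocalIso`).
[cite: SerreLocalFields1979, XIII §3 Cor. 3] -/
theorem natCard_two_muAt_subgroup_eq [hS : IsClosed (S : Set (Field.absoluteGaloisGroup (v.adicCompletion K)))] :
    Nat.card (continuousCohomology 2 ((muAt K n v).restrict (subgroupIncl S)).toTopRep) = n := by
  haveI : CharZero (v.adicCompletion K) := charZero_adicCompletion v
  haveI : S.FiniteIndex := Subgroup.finiteIndex_of_finite_quotient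
  have hSopen : IsOpen (S : Set (Field.absoluteGaloisGroup (v.adicCompletion K))) :=
    Subgroup.isOpen_of_isClosed_of_finiteIndex S hS
  let e := muLocalIso (K := K) v n
  let eS : ((muAt K n v).restrict (subgroupIncl S)).toTopRep ≅
      ((mu (v.adicCompletion K) n).restrict (subgroupIncl S)).toTopRep :=
    { hom := resModHom S (ρ := muAt K n v) (ρ' := mu (v.adicCompletion K) n) e.hom
      inv := resModHom S (ρ := mu (v.adicCompletion K) n) (ρ' := muAt K n v) e.inv
      hom_inv_id := TopRep.hom_ext (ContIntertwiningMap.ext (ContinuousLinearMap.ext fun x => by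
        change e.inv.hom (e.hom.hom x) = x
        rw [← TopRep.comp_apply, e.hom_inv_id, TopRep.id_apply]))
      inv_hom_id := TopRep.hom_ext (ContIntertwiningMap.ext (ContinuousLinearMap.ext fun y => by
        change e.hom.hom (e.inv.hom y) = y
        rw [← TopRep.comp_apply, e.inv_hom_id, TopRep.id_apply])) }
  rw [Nat.card_congr (continuousCohomologyEquivOfIso eS 2)]
  exact natCard_two_mu_eq_of_isOpen (v.adicCompletion K) S hSopen n

/-- **The local invariant map `inv_S = inv_v ∘ cor_{Γ_{K_v}/S} : H²(S, μₙ(K̄)|_S) → ℤ/n` of an open normal subgroup is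
BIJECTIVE** — it IS the invariant map `Br(L)[n] ⥲ ℤ/n` of `L = K̄_v^S` (injective by `localInvariantMapSubgroup_injective`, and both
sides have `n` elements, `natCard_two_muAt_subgroup_eq`).  This is the normalisation input of the layer-wise local Tate pairings
`localPairingSubgroup`. [cite: SerreLocalFields1979, XIII §3 Cor. 3, XI §2 Prop. 1 (ii)] -/
theorem localInvariantMapSubgroup_bijective [S.Normal] : Bijective (localInvariantMapSubgroup K n v S) := by
  have hn : Nat.card (continuousCohomology 2 ((muAt K n v).restrict (subgroupIncl S)).toTopRep) = n :=
    natCard_two_muAt_subgroup_eq K n v S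
  haveI : Finite (continuousCohomology 2 ((muAt K n v).restrict (subgroupIncl S)).toTopRep) :=
    Nat.finite_of_card_ne_zero (by rw [hn]; exact NeZero.ne n)
  refine (localInvariantMapSubgroup_injective K n v S).bijective_of_nat_card_le ?_
  rw [hn, Nat.card_zmod]

end Literature.NumberTheory.GaloisCohomology

end
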